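import Summits.HodgeConjecture.HodgeConjecture.Theses.MilnorKExponential
import Summits.HodgeConjecture.HodgeConjecture.Theorems.MilnorKExponentialSymbolClassesHodgeType
import Summits.HodgeConjecture.HodgeConjecture.Theorems.MilnorKExponentialDefs
import Literature.AlgebraicGeometry.HodgeTheory.SymbolClasses

/-!
# STRATEGY CENSUS r1 (second opinion) — crux `SymbolClassesAlgebraic` (GK_p, stmt-HodgeConjecture-17743)

Lean companion of `Cruxes/SymbolClassesAlgebraic/STRATEGY-CENSUS-r1.md` (crux-strategist
`cstrat-stmt-HodgeConjecture-17743-r1`, 2026-08-17). Everything here is sorry-free.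

§1 RELATIVE SUMMIT STRENGTH (the theorem the tribunal asked for). With the two PROVED items of the
   route (`SymbolClassesHodgeType` = `L ⊆ Hdg`, `HodgeModelsExist`) the crux GK is sandwiched:
   `HodgeConjecture → SymbolClassesAlgebraic` (`crux_of_hodgeConjecture`) and
   `SymbolClassesAlgebraic → SymbolLiftR → HodgeConjecture` (`hodgeConjecture_of_crux_of_lift`, the
   route's `closes`). Hence `SymbolLiftR → (HodgeConjecture ↔ SymbolClassesAlgebraic)`
   (`hodgeConjecture_iff_crux_of_lift`): modulo the route's OWN second crux the crux is the summit,
   and GK is strictly easier than HC only in worlds where LIFT fails — where the route is dead.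
   With the open typing item `Alg ⊆ L` (stmt-18703) the pair is a CONJUNCT SPLIT of the summit:
   `(SymbolClassesAlgebraic ∧ SymbolLiftR) ↔ HodgeConjecture` (`crux_and_lift_iff_hodgeConjecture`).
§2 POINTWISE SANDWICH. The same per variety and weight (`HCAt`, `GKAt`, `LiftAt` over the tree's
   named `IsSymbolClass`): `HCAt → GKAt` and `LiftAt → (HCAt ↔ GKAt)` at every `(n, X, q)` — there is
   no regime `(X, p)` in which GK is decided by anything but HC itself (all proved slices of GK in the
   tree — weight 1, `n ≤ 3`, `p ≥ n − 1`, outside the band — are slices where HC is a theorem).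
§3 THE r1 WALL, TYPED. `IsRegularUnitOn` (a holomorphic unit that is locally a ratio of regular
   functions = a Nash unit of degree 1), regular symbol cocycles/classes, `RegularDescent`
   (= MEROMORPHIC NORMAL FORM: every rational symbol class is a regular-unit symbol class),
   `RegularSymbolConiveauOne` / `RegularSymbolClassesAlgebraicTwo` (the statements the census shows
   PROVABLE by Deligne's weights with NO change of cover — bankable support theorems, not stubs of a
   line), and the two height certificates `regularDescent_of_gk` (RegularDescent ⇐ GK ∧ Alg ⊆ L_reg:
   GK-height, exactly like `nashDescent_of_gk`) and `nashDescent_of_regularDescent` (it is even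
   STRONGER than the dead line's stub A).
-/

noncomputable section

set_option linter.dupNamespace false

namespace Summit.HodgeConjecture.HodgeConjecture.Cruxes.SymbolClassesAlgebraic.CensusR1

open scoped Manifold Topology
open CategoryTheory AlgebraicGeometry Filter
open Literature.AlgebraicGeometry Literature.AlgebraicGeometry.HodgeTheory
  Literature.AlgebraicGeometry.Motives Literature.Geometry.Kaehler
  Literature.NumberTheory.Transcendental
open Summit.HodgeConjecture.HodgeConjecture.Theses.MilnorKExponential
  (SymbolClassesAlgebraic SymbolClassesHodgeType SymbolLiftR HodgeModelsExist
    AlgebraicClassesAreSymbolClasses HodgeModelsExist_holds closes)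
open Summit.HodgeConjecture.HodgeConjecture.Theorems (symbolClassesHodgeType_proof)
open Summit.HodgeConjecture.HodgeConjecture.Theorems.MilnorKExponentialNash

/-! ### §1 Relative summit strength -/

/-- **HC ⇒ GK**, unconditionally in the tree: the typing item `L ⊆ Hdg` is the PROVED route item
`SymbolClassesHodgeType` (`Theorems.symbolClassesHodgeType_proof`). [cite: Deligne2000, §1] -/
theorem crux_of_hodgeConjecture (hHC : _root_.HodgeConjecture) : SymbolClassesAlgebraic :=
  fun _ _ hX q c hc hs ↦ (hHC hX).2 (q + 1) c hc (symbolClassesHodgeType_proof hX q c hc hs)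

/-- **GK ∧ LIFT ⇒ HC** — the route's deciding theorem `closes`, its anti-vacuity binder discharged
by the PROVED item `HodgeModelsExist`. [cite: Deligne2000, §1] -/
theorem hodgeConjecture_of_crux_of_lift (hGK : SymbolClassesAlgebraic) (hL : SymbolLiftR) :
    _root_.HodgeConjecture :=
  closes HodgeModelsExist_holds hGK hL

/-- **The relative summit-strength theorem**: modulo the route's own second crux LIFT, the crux
GK IS the Hodge conjecture. [cite: Deligne2000, §1] -/
theorem hodgeConjecture_iff_crux_of_lift (hL : SymbolLiftR) :
    _root_.HodgeConjecture ↔ SymbolClassesAlgebraic :=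
  ⟨crux_of_hodgeConjecture, fun hGK ↦ hodgeConjecture_of_crux_of_lift hGK hL⟩

/-- **HC ⇒ LIFT** given the typing item `Alg ⊆ L` (stmt-18703, open, route support): an algebraic
class is a symbol class. [cite: Deligne2000, §1] -/
theorem lift_of_hodgeConjecture (hA : AlgebraicClassesAreSymbolClasses)
    (hHC : _root_.HodgeConjecture) : SymbolLiftR :=
  fun _ _ hX q hq c hc hpp ↦ hA hX q hq c hc ((hHC hX).2 (q + 1) c hc hpp)

/-- **Conjunct split**: given the typing item `Alg ⊆ L`, the route's two cruxes are JOINTLY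
EQUIVALENT to the summit. [cite: Deligne2000, §1] -/
theorem crux_and_lift_iff_hodgeConjecture (hA : AlgebraicClassesAreSymbolClasses) :
    (SymbolClassesAlgebraic ∧ SymbolLiftR) ↔ _root_.HodgeConjecture :=
  ⟨fun h ↦ hodgeConjecture_of_crux_of_lift h.1 h.2,
    fun h ↦ ⟨crux_of_hodgeConjecture h, lift_of_hodgeConjecture hA h⟩⟩

/-- **¬GK ⇒ ¬HC**, unconditional form of `Negative/Ceiling`. [cite: Deligne2000, §1] -/
theorem not_hodgeConjecture_of_not_crux (h : ¬ SymbolClassesAlgebraic) : ¬ _root_.HodgeConjecture :=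
  fun hHC ↦ h (crux_of_hodgeConjecture hHC)

/-! ### §2 Pointwise sandwich (per variety and weight) -/

section Pointwise

variable (n : ℕ) (X : SchemeOver ℂ)

/-- The Hodge conjecture for `X` in codimension `p` (the algebraicity conjunct of
`HodgeConjectureFor`). [cite: Deligne2000, §1] -/
def HCAt (p : ℕ) : Prop :=
  ∀ c : complexBetti X (2 * p), IsRationalClass c → IsOfHodgeType n X (2 * p) p p c →
    c ∈ algebraicClasses X p

/-- GK for `X` in weight `q + 1` (named form over `IsSymbolClass`). -/
def GKAt (q : ℕ) : Prop :=
  ∀ c : complexBetti X (2 * (q + 1)), IsRationalClass c → IsSymbolClass n X q c →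
    c ∈ algebraicClasses X (q + 1)

/-- LIFT for `X` in weight `q + 1` (named form over `IsSymbolClass`). -/
def LiftAt (q : ℕ) : Prop :=
  ∀ c : complexBetti X (2 * (q + 1)), IsRationalClass c →
    IsOfHodgeType n X (2 * (q + 1)) (q + 1) (q + 1) c → IsSymbolClass n X q c

variable {n X}

/-- `L ⊆ Hdg` in named form holds (from the proved route item, by the guard bookkeeping of
`gkNamed_of_route`). [cite: VoisinHodgeI2002, §7.1.1] -/
theorem hodgeTypeNamed_holds : HodgeTypeNamed := by
  intro n X hX q c hc hs
  by_cases hc0 : c = 0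
  · obtain ⟨A⟩ := hs.nonempty_hodgeModel
    rw [hc0]; exact IsOfHodgeType.zero A _ _ _
  obtain ⟨A, hN, hS⟩ := hs.exists_isSymbolNormalized hc0
  obtain ⟨ι, hι, U, hU, hcov, σ, ⟨hg, hco⟩, θ, m, hm, hT, hdR⟩ := hS
  exact symbolClassesHodgeType_proof hX q c hc ⟨A, hN, ι, hι, U, hU, hcov, σ, hg, hco, θ, m, hm, hT, hdR⟩

/-- **HC(X, q+1) ⇒ GK(X, q)** at every variety and weight. [cite: Deligne2000, §1] -/
theorem gkAt_of_hcAt (hX : IsSmoothProjective n X) {q : ℕ} (h : HCAt n X (q + 1)) : GKAt n X q :=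
  fun c hc hs ↦ h c hc (hodgeTypeNamed_holds hX q c hc hs)

/-- **GK(X, q) ∧ LIFT(X, q) ⇒ HC(X, q+1)**. [cite: Deligne2000, §1] -/
theorem hcAt_of_gkAt_of_liftAt {q : ℕ} (hG : GKAt n X q) (hL : LiftAt n X q) : HCAt n X (q + 1) :=
  fun c hc hpp ↦ hG c hc (hL c hc hpp)

/-- **Pointwise relative summit strength**: under LIFT(X, q), GK(X, q) is HC(X, q+1).
[cite: Deligne2000, §1] -/
theorem hcAt_iff_gkAt_of_liftAt (hX : IsSmoothProjective n X) {q : ℕ} (hL : LiftAt n X q) :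
    HCAt n X (q + 1) ↔ GKAt n X q :=
  ⟨gkAt_of_hcAt hX, fun hG ↦ hcAt_of_gkAt_of_liftAt hG hL⟩

/-- The global crux is the conjunction of its instances (bridge to the route decl through
`route_of_gkNamed` / `gkNamed_of_route`). [folklore] -/
theorem crux_iff_forall_gkAt :
    SymbolClassesAlgebraic ↔ ∀ ⦃n : ℕ⦄ ⦃X : SchemeOver ℂ⦄, IsSmoothProjective n X → ∀ q, GKAt n X q :=
  ⟨fun h _ _ hX q c hc hs ↦ gkNamed_of_route h hX q c hc hs,
    fun h ↦ route_of_gkNamed fun _ _ hX q c hc hs ↦ h hX q c hc hs⟩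

/-- The summit is the conjunction of its instances plus anti-vacuity. [cite: Deligne2000, §1] -/
theorem hodgeConjecture_iff_forall_hcAt :
    _root_.HodgeConjecture ↔
      ∀ ⦃n : ℕ⦄ ⦃X : SchemeOver ℂ⦄, IsSmoothProjective n X → ∀ p, HCAt n X p :=
  ⟨fun h _ _ hX p c hc hpp ↦ (h hX).2 p c hc hpp,
    fun h _ X hX ↦ ⟨HodgeModelsExist_holds _ X hX, fun p c hc hpp ↦ h hX p c hc hpp⟩⟩

end Pointwise

/-! ### §3 The r1 wall, typed: regular (meromorphic) normal form -/

section Regular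

variable {n : ℕ} {X : SchemeOver ℂ}

/-- **`f` is a REGULAR unit on `W ⊆ X^an`**: a holomorphic unit which near every point of `W` is a
ratio of regular functions of `X` — a Nash unit of degree `1` (`a₀ + a₁ f = 0` with `a₁ ≢ 0`), i.e.
the restriction of a RATIONAL function of `X` (= a global meromorphic function of `X^an`, Serre
GAGA / Chow) that is a unit on `W`. [cite: SerreGAGA1956, §2] -/
def IsRegularUnitOn (A : HodgeModel n X) (W : Set A.carrier) (f : A.carrier → ℂ) : Prop :=
  IsHolUnitOn A.model W f ∧
    ∀ x ∈ W, ∃ (U : X.left.affineOpens) (a : Fin (1 + 1) → Γ(X.left, (↑U : X.left.Opens))),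
      (A.toComplexPoints x).pt ∈ (↑U : X.left.Opens) ∧
      (∃ i, ∃ᶠ y in 𝓝 x, AlgPoints.evalOrZero (↑U : X.left.Opens) (a i) (A.toComplexPoints y) ≠ 0) ∧
      ∀ᶠ y in 𝓝 x, y ∈ W →
        ∑ i, AlgPoints.evalOrZero (↑U : X.left.Opens) (a i) (A.toComplexPoints y) * f y ^ (i : ℕ) = 0

/-- A regular unit is a Nash unit (degree `1`). [folklore] -/
theorem IsRegularUnitOn.isNashUnitOn {A : HodgeModel n X} {W : Set A.carrier} {f : A.carrier → ℂ}
    (h : IsRegularUnitOn A W f) : IsNashUnitOn A W f :=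
  ⟨h.1, fun x hx ↦ let ⟨U, a, hU, hi, hf⟩ := h.2 x hx; ⟨U, 1, a, hU, hi, hf⟩⟩

/-- Regular-good tuples. [folklore] -/
def IsRegularGoodTuple (A : HodgeModel n X) (W : Set A.carrier) {p : ℕ}
    (t : Fin p → A.carrier → ℂ) : Prop :=
  ∀ i, IsRegularUnitOn A W (t i)

theorem IsRegularGoodTuple.isNashGoodTuple {A : HodgeModel n X} {W : Set A.carrier} {p : ℕ}
    {t : Fin p → A.carrier → ℂ} (h : IsRegularGoodTuple A W t) : IsNashGoodTuple A W t :=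
  fun i ↦ (h i).isNashUnitOn

/-- The naive Milnor relations with REGULAR witnesses. [cite: Esnault1990CycleMap, §3] -/
def regularMilnorRel (A : HodgeModel n X) (W : Set A.carrier) (p : ℕ) :
    AddSubgroup ((Fin p → A.carrier → ℂ) →₀ ℤ) :=
  AddSubgroup.closure
    ({s | ∃ t t' : Fin p → A.carrier → ℂ, IsRegularGoodTuple A W t ∧ IsRegularGoodTuple A W t' ∧
        (∀ i, ∀ x ∈ W, t i x = t' i x) ∧ s = Finsupp.single t 1 - Finsupp.single t' 1} ∪
      {s | ∃ (t : Fin p → A.carrier → ℂ) (i : Fin p) (g : A.carrier → ℂ), IsRegularGoodTuple A W t ∧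
        IsRegularUnitOn A W g ∧
        s = Finsupp.single (Function.update t i (t i * g)) 1 - Finsupp.single t 1 -
          Finsupp.single (Function.update t i g) 1} ∪
      {s | ∃ (t : Fin p → A.carrier → ℂ) (i j : Fin p), IsRegularGoodTuple A W t ∧ i ≠ j ∧
        (∀ x ∈ W, t i x + t j x = 1) ∧ s = Finsupp.single t 1})

theorem regularMilnorRel_le_nashMilnorRel (A : HodgeModel n X) (W : Set A.carrier) (p : ℕ) :
    regularMilnorRel A W p ≤ nashMilnorRel A W p := by
  refine AddSubgroup.closure_mono ?_
  refine Set.union_subset_union (Set.union_subset_union ?_ ?_) ?_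
  · rintro s ⟨t, t', ht, ht', he, rfl⟩
    exact ⟨t, t', ht.isNashGoodTuple, ht'.isNashGoodTuple, he, rfl⟩
  · rintro s ⟨t, i, g, ht, hg, rfl⟩
    exact ⟨t, i, g, ht.isNashGoodTuple, hg.isNashUnitOn, rfl⟩
  · rintro s ⟨t, i, j, ht, hij, h1, rfl⟩
    exact ⟨t, i, j, ht.isNashGoodTuple, hij, h1, rfl⟩

/-- Regular Milnor symbol cocycles of an open cover. [cite: Esnault1990CycleMap, §3] -/
def IsRegularSymbolCocycle (A : HodgeModel n X) {ι : Type*} (U : ι → Set A.carrier) {m p : ℕ}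
    (σ : (Fin (m + 1) → ι) → ((Fin p → A.carrier → ℂ) →₀ ℤ)) : Prop :=
  (∀ J, ∀ t ∈ (σ J).support, IsRegularGoodTuple A (cechSet U J) t) ∧
    ∀ J' : Fin (m + 2) → ι, symbolδ σ J' ∈ regularMilnorRel A (cechSet U J') p

theorem IsRegularSymbolCocycle.isNashSymbolCocycle {A : HodgeModel n X} {ι : Type*}
    {U : ι → Set A.carrier} {m p : ℕ} {σ : (Fin (m + 1) → ι) → ((Fin p → A.carrier → ℂ) →₀ ℤ)}
    (h : IsRegularSymbolCocycle A U σ) : IsNashSymbolCocycle A U σ :=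
  ⟨fun J t ht ↦ (h.1 J t ht).isNashGoodTuple, fun J' ↦ regularMilnorRel_le_nashMilnorRel A _ p (h.2 J')⟩

/-- `c` is carried by a REGULAR symbol cocycle of weight `q + 1` on the model `A`. -/
def HasRegularSymbolCocycle (A : HodgeModel n X) (q : ℕ) (c : complexBetti X (2 * (q + 1))) : Prop :=
  ∃ (ι : Type) (_ : Fintype ι) (U : ι → Set A.carrier) (hU : ∀ i, IsOpen (U i))
    (_ : ∀ x, ∃ i, x ∈ U i) (σ : (Fin (q + 2) → ι) → ((Fin (q + 1) → (A.carrier → ℂ)) →₀ ℤ))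
    (_ : IsRegularSymbolCocycle A U σ)
    (θ : cclosedSmoothForms A.model A.carrier (2 * q + 1 + 1)) (m : ℤ),
    m ≠ 0 ∧ IsTransgression hU q (fun J ↦ symbolForm A.model (q + 1) (σ J)) θ ∧
      A.deRham A.carrier (2 * q + 1 + 1)
          (complexDeRhamCohomology.mk A.model A.carrier (2 * q + 1 + 1) θ) =
        (m : ℂ) • A.pullback (2 * q + 1 + 1) c

theorem HasRegularSymbolCocycle.hasNashSymbolCocycle {A : HodgeModel n X} {q : ℕ}
    {c : complexBetti X (2 * (q + 1))} (h : HasRegularSymbolCocycle A q c) :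
    HasNashSymbolCocycle A q c := by
  obtain ⟨ι, hι, U, hU, hcov, σ, hσ, θ, m, hm, hT, hdR⟩ := h
  exact ⟨ι, hι, U, hU, hcov, σ, hσ.isNashSymbolCocycle, θ, m, hm, hT, hdR⟩

variable (n X) in
/-- **Regular symbol classes of weight `q + 1`** (same normalisation guard as `IsSymbolClass`). -/
def IsRegularSymbolClass (q : ℕ) (c : complexBetti X (2 * (q + 1))) : Prop :=
  ∃ A : HodgeModel n X,
    (Nontrivial (complexBetti X (2 * (q + 1))) → A.IsSymbolNormalized q) ∧ HasRegularSymbolCocycle A q c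

theorem IsRegularSymbolClass.isNashSymbolClass {q : ℕ} {c : complexBetti X (2 * (q + 1))}
    (h : IsRegularSymbolClass n X q c) : IsNashSymbolClass n X q c :=
  let ⟨A, hN, hc⟩ := h
  ⟨A, hN, hc.hasNashSymbolCocycle⟩

theorem IsRegularSymbolClass.isSymbolClass {q : ℕ} {c : complexBetti X (2 * (q + 1))}
    (h : IsRegularSymbolClass n X q c) : IsSymbolClass n X q c :=
  h.isNashSymbolClass.isSymbolClass

/-- **MEROMORPHIC NORMAL FORM (the r1 wall)**: every rational symbol class is a REGULAR symbol
class — its cocycle has, modulo the Milnor relations, refinement, de-Rham-invisible cocycles and a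
non-zero integer multiple, a representative whose units are restrictions of rational functions of
`X`. Route-posited STATEMENT (untagged). -/
def RegularDescent : Prop :=
  ∀ ⦃n : ℕ⦄ ⦃X : SchemeOver ℂ⦄, IsSmoothProjective n X →
    ∀ (q : ℕ) (c : complexBetti X (2 * (q + 1))), IsRationalClass c → IsSymbolClass n X q c →
      IsRegularSymbolClass n X q c

/-- **Coniveau one for regular symbol classes** — the statement the census r1 shows PROVABLE by
Deligne's weights WITHOUT a change of cover (remove the divisors of all units; the coefficient forms
become global; a Čech cocycle with global coefficients transgresses to `Σ [n_k] ∪ [α_k]`; cup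
products with Kummer classes of units are killed by weights, tree fact
`deligne1971_weightKill_cupUnits` with `d = 2q + 1`). Bankable support theorem (L–XL), not a stub
of a line. [cite: DeligneHodgeII1971, Cor. 3.2.15 and Cor. 3.2.17] -/
def RegularSymbolConiveauOne : Prop :=
  ∀ ⦃n : ℕ⦄ ⦃X : SchemeOver ℂ⦄, IsSmoothProjective n X →
    ∀ (q : ℕ) (c : complexBetti X (2 * (q + 1))), IsRationalClass c → IsRegularSymbolClass n X q c →
      c ∈ supportedClasses X (2 * (q + 1)) 1

/-- **Regular symbol classes of weight 2 are algebraic** (`RegularSymbolConiveauOne` in weight 2 +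
Lefschetz (1,1) on the resolved support, Voisin's lemma with `p = 1`): the bankable theorem RegGK₂ of
the census r1. [cite: DeligneHodgeII1971, Cor. 3.2.17] [cite: VoisinHodgeI2002, §11.3] -/
def RegularSymbolClassesAlgebraicTwo : Prop :=
  ∀ ⦃n : ℕ⦄ ⦃X : SchemeOver ℂ⦄, IsSmoothProjective n X →
    ∀ (c : complexBetti X (2 * (1 + 1))), IsRationalClass c → IsRegularSymbolClass n X 1 c →
      c ∈ algebraicClasses X (1 + 1)

/-- `Alg ⊆ L_reg`: the Zariski form of the route's typing item `Alg ⊆ L` (stmt-18703): the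
Bloch–Quillen–Kerz / Koszul cocycles of an algebraic cycle have REGULAR units. Route-posited
STATEMENT (untagged). [cite: Kerz2009, Thm. 1.1] -/
def AlgebraicClassesAreRegularSymbolClasses : Prop :=
  ∀ ⦃n : ℕ⦄ ⦃X : SchemeOver ℂ⦄, IsSmoothProjective n X →
    ∀ (q : ℕ) (c : complexBetti X (2 * (q + 1))), IsRationalClass c →
      c ∈ algebraicClasses X (q + 1) → IsSymbolClass n X q c → IsRegularSymbolClass n X q c

/-- **HEIGHT CERTIFICATE**: meromorphic normal form is a consequence of the crux given the Zariski
typing `Alg ⊆ L_reg` — it sits at the height of GK (the census's costume test), exactly like the dead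
line's stub A (`nashDescent_of_gk`). [folklore] -/
theorem regularDescent_of_gk (h : GKNamed) (hAlg : AlgebraicClassesAreRegularSymbolClasses) :
    RegularDescent :=
  fun _ _ hX q c hc hs ↦ hAlg hX q c hc (h hX q c hc hs) hs

/-- … and it is even STRONGER than the dead line's stub A (regular ⊆ Nash). [folklore] -/
theorem nashDescent_of_regularDescent (h : RegularDescent) : NashDescent :=
  fun _ _ hX q c hc hs ↦ (h hX q c hc hs).isNashSymbolClass

/-- **The typed split of census r1 (D6), weight 2**: meromorphic normal form + RegGK₂ give GK₂
(named form, weight 2). The seam is modus ponens; the content is in the two pieces — RegGK₂ provable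
(Deligne), RegularDescent GK-height with no printed route: the split is recorded, not filed. [folklore] -/
theorem gkAt_one_of_regularDescent (hD : RegularDescent) (hR : RegularSymbolClassesAlgebraicTwo)
    ⦃n : ℕ⦄ ⦃X : SchemeOver ℂ⦄ (hX : IsSmoothProjective n X) : GKAt n X 1 :=
  fun c hc hs ↦ hR hX c hc (hD hX 1 c hc hs)

/-- RegGK₂ is BELOW the crux (a special case through the forgetful map regular ⇒ symbol) — it is a
witness-data restriction of GK₂ valid on every `X`, decided (once landed) where HC is not.
[folklore] -/
theorem regularSymbolClassesAlgebraicTwo_of_gk (h : GKNamed) : RegularSymbolClassesAlgebraicTwo :=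
  fun _ _ hX c hc hs ↦ h hX 1 c hc hs.isSymbolClass

end Regular

end Summit.HodgeConjecture.HodgeConjecture.Cruxes.SymbolClassesAlgebraic.CensusR1

end
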